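import Mathlib
import HarnessLib
import Literature.Analysis.FluidPDE.AxisymHouLiVariables
import Summits.NavierStokesRegularity.NavierStokesRegularity.Theorems.PoloidalWindowDoorLrcModEntireAxisKinematics2
import Summits.NavierStokesRegularity.NavierStokesRegularity.Theorems.PoloidalWindowDoorLrcModEntireAxisKinematics7
import Summits.NavierStokesRegularity.NavierStokesRegularity.Theorems.PoloidalWindowDoorPoloidalWindowRigidityClebschVorticity
import Summits.NavierStokesRegularity.NavierStokesRegularity.Theorems.PoloidalWindowDoorPoloidalWindowRigidityConstantShearMeans

/-!
# Route `PoloidalWindowDoor`, item `LrcModEntire` (stmt-NavierStokesRegularity-20428) — AXIS KINEMATICS XIV: the hypothesis (S) of the axis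
# theorem is KINEMATIC: «vertical shear = radial horizontal gradient» + `div u = 0` ⇒ `∂₂²u₂` is rotation-invariant per height

Cell ns-regularity-ideate, seat ns-poloidal-K2-p3 gen 5 (LEAD of item 20428; file landed `--supports stmt-NavierStokesRegularity-20428` as a
helper).  AXIS-NOTE steps 2–3.  Data: a divergence-free `u ∈ C³(ℝ³; ℝ³)`, a scalar `q ∈ C³(ℝ³)`, a centre curve `(c₀, c₁)` and an open `O`
on which (shear) `∂₂u_b = ∂_b q` for `b = 0, 1` (the structure-function form of the proportional vertical shear of the registered stubs,
`…StructureFunctionT0`) and (radial) `L q = 0`, `L = (y₀ − c₀(y₂))∂₁ − (y₁ − c₁(y₂))∂₀`.  THEN (S): `L(∂₂²u₂) = 0` on `O`.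
Derivation: `∂₂²u₂ = −∂₂(∂₀u₀ + ∂₁u₁) = −(∂₀∂₂u₀ + ∂₁∂₂u₁) = −Δ_h q` on `O` (symmetry of second derivatives and (shear)), and
`L(Δ_h q) = Δ_h(L q) = 0` at the points of `O`: the commutation `[Δ_h, L_c] = 0` of `…AxisKinematics2.laplacianH_rotDeriv` holds for the
FROZEN centre `c = c(y₂)`; the frozen generator `L_c q` agrees with the moving one on the plane `{y'₂ = y₂}`, where it vanishes, and
horizontal first and second derivatives only see the plane (`…AxisKinematics7.fderiv_apply_eq_of_eqOn_plane_nhds`).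

* `vert2_apply_two_eq_neg_laplacianH` — `∂₂²u₂ = −Δ_h q` on `O`.
* `rotDeriv_laplacianH_eq_zero_of_plane` — `L_{c(y₂)}(Δ_h q)(y) = 0` from `L q = 0` on `O` (moving centre).
* `vert2_rotInvariant_of_shear` — (S).

WHAT THIS IS NOT: not a claim about Navier–Stokes regularity — kinematics (bears_on LADDER-NS N0 via item 20428).
-/

noncomputable section

-- the summit and its single sub-problem share the name (CONVENTIONS §1), as in every Theorems file
set_option linter.dupNamespace false

namespace Summit.NavierStokesRegularity.NavierStokesRegularity.Theorems.PoloidalWindowDoorLrcModEntireAxisKinematics14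

open Set Function Filter Topology Metric
open scoped RealInnerProductSpace InnerProductSpace
open Literature.Analysis Literature.Analysis.FluidPDE
open Summit.NavierStokesRegularity.NavierStokesRegularity.Theorems.PoloidalWindowDoorPoloidalWindowRigidityConstantShearMeans
open Summit.NavierStokesRegularity.NavierStokesRegularity.Theorems.PoloidalWindowDoorPoloidalWindowRigidityClebschVorticity
open Summit.NavierStokesRegularity.NavierStokesRegularity.Theorems.PoloidalWindowDoorLrcModEntireAxisKinematics
open Summit.NavierStokesRegularity.NavierStokesRegularity.Theorems.PoloidalWindowDoorLrcModEntireAxisKinematics2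
open Summit.NavierStokesRegularity.NavierStokesRegularity.Theorems.PoloidalWindowDoorLrcModEntireAxisKinematics7

/-- **`∂₂²u₂ = −Δ_h q` on `O`.**  For a divergence-free `u ∈ C³` and `q ∈ C³` with `∂₂u_b = ∂_b q` (`b = 0, 1`) on an open `O`. -/
theorem vert2_apply_two_eq_neg_laplacianH {u : EuclideanSpace ℝ (Fin 3) → EuclideanSpace ℝ (Fin 3)} (hu : ContDiff ℝ 3 u)
    {q : EuclideanSpace ℝ (Fin 3) → ℝ} (hdiv : VectorCalculus.IsDivFree u)
    {O : Set (EuclideanSpace ℝ (Fin 3))} (hO : IsOpen O)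
    (hshear : ∀ y ∈ O, ∀ b : Fin 3, b ≠ 2 →
      fderiv ℝ u y (EuclideanSpace.single 2 1) b = fderiv ℝ q y (EuclideanSpace.single b 1))
    {y : EuclideanSpace ℝ (Fin 3)} (hy : y ∈ O) :
    fderiv ℝ (fun y' => fderiv ℝ (fun x => u x 2) y' (EuclideanSpace.single 2 1)) y (EuclideanSpace.single 2 1) =
      -(fderiv ℝ (fun y' => fderiv ℝ q y' (EuclideanSpace.single 0 1)) y (EuclideanSpace.single 0 1) +
        fderiv ℝ (fun y' => fderiv ℝ q y' (EuclideanSpace.single 1 1)) y (EuclideanSpace.single 1 1)) := by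
  have hu2 : ContDiff ℝ 2 u := hu.of_le (by norm_num)
  have hub : ∀ b : Fin 3, ContDiff ℝ 2 (fun x => u x b) := fun b =>
    (EuclideanSpace.proj b : EuclideanSpace ℝ (Fin 3) →L[ℝ] ℝ).contDiff.comp hu2
  -- coordinates of derivatives as derivatives of coordinates
  have hcoord : ∀ (b : Fin 3) (a : EuclideanSpace ℝ (Fin 3)),
      (fun y' => fderiv ℝ (fun x => u x b) y' a) = fun y' => fderiv ℝ u y' a b := by
    intro b a; funext y'; exact fderiv_coord_apply ((hu.differentiable (by norm_num)) y') b a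
  -- `div u = 0` differentiated along `e₂`
  have hd := fderiv_divergence_components_eq_zero hu2 hdiv y (EuclideanSpace.single 2 1)
  -- symmetry of the second derivatives of the coordinates `u_b`
  have hsym : ∀ (b : Fin 3) (a w : EuclideanSpace ℝ (Fin 3)),
      fderiv ℝ (fun y' => fderiv ℝ u y' a b) y w = fderiv ℝ (fun y' => fderiv ℝ u y' w b) y a := by
    intro b a w
    rw [← hcoord b a, ← hcoord b w, PoloidalWindowDoorPoloidalWindowRigidityClebschVorticity.fderiv_fderiv_apply_const (hub b),
      PoloidalWindowDoorPoloidalWindowRigidityClebschVorticity.fderiv_fderiv_apply_const (hub b)]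
    exact ((hub b).contDiffAt).isSymmSndFDerivAt (by simp) w a
  -- (shear) differentiated along `e_b`
  have hsh : ∀ b : Fin 3, b ≠ 2 →
      fderiv ℝ (fun y' => fderiv ℝ u y' (EuclideanSpace.single 2 1) b) y (EuclideanSpace.single b 1) =
        fderiv ℝ (fun y' => fderiv ℝ q y' (EuclideanSpace.single b 1)) y (EuclideanSpace.single b 1) := by
    intro b hb
    have hev : (fun y' => fderiv ℝ u y' (EuclideanSpace.single 2 1) b) =ᶠ[𝓝 y]
        fun y' => fderiv ℝ q y' (EuclideanSpace.single b 1) :=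
      Filter.eventually_of_mem (hO.mem_nhds hy) fun z hz => hshear z hz b hb
    rw [hev.fderiv_eq]
  rw [hcoord 2 (EuclideanSpace.single 2 1)]
  rw [hsym 0 (EuclideanSpace.single 0 1) (EuclideanSpace.single 2 1),
    hsym 1 (EuclideanSpace.single 1 1) (EuclideanSpace.single 2 1), hsh 0 (by decide), hsh 1 (by decide)] at hd
  linarith

/-- **`L_{c(y₂)}(Δ_h q)(y) = 0` from `L q = 0` on `O` (moving centre).**  For `q ∈ C³`, an open `O` and `y ∈ O`: if
`(y'₀ − c₀(y'₂))∂₁q(y') − (y'₁ − c₁(y'₂))∂₀q(y') = 0` for all `y' ∈ O`, then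
`(y₀ − c₀(y₂))∂₁(Δ_h q)(y) − (y₁ − c₁(y₂))∂₀(Δ_h q)(y) = 0`. -/
theorem rotDeriv_laplacianH_eq_zero_of_plane {q : EuclideanSpace ℝ (Fin 3) → ℝ} (hq : ContDiff ℝ 3 q) {c₀ c₁ : ℝ → ℝ}
    {O : Set (EuclideanSpace ℝ (Fin 3))} (hO : IsOpen O)
    (hLq : ∀ y ∈ O, (y 0 - c₀ (y 2)) * fderiv ℝ q y (EuclideanSpace.single 1 1) -
      (y 1 - c₁ (y 2)) * fderiv ℝ q y (EuclideanSpace.single 0 1) = 0)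
    {y : EuclideanSpace ℝ (Fin 3)} (hy : y ∈ O) :
    (y 0 - c₀ (y 2)) *
        fderiv ℝ (fun y' => fderiv ℝ (fun y'' => fderiv ℝ q y'' (EuclideanSpace.single 0 1)) y' (EuclideanSpace.single 0 1) +
          fderiv ℝ (fun y'' => fderiv ℝ q y'' (EuclideanSpace.single 1 1)) y' (EuclideanSpace.single 1 1)) y
          (EuclideanSpace.single 1 1) -
      (y 1 - c₁ (y 2)) *
        fderiv ℝ (fun y' => fderiv ℝ (fun y'' => fderiv ℝ q y'' (EuclideanSpace.single 0 1)) y' (EuclideanSpace.single 0 1) +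
          fderiv ℝ (fun y'' => fderiv ℝ q y'' (EuclideanSpace.single 1 1)) y' (EuclideanSpace.single 1 1)) y
          (EuclideanSpace.single 0 1) = 0 := by
  -- the frozen centre
  set cf : EuclideanSpace ℝ (Fin 3) := WithLp.toLp 2 ![c₀ (y 2), c₁ (y 2), 0] with hcf
  have hcf0 : cf 0 = c₀ (y 2) := rfl
  have hcf1 : cf 1 = c₁ (y 2) := rfl
  -- the frozen generator applied to `q`
  set g : EuclideanSpace ℝ (Fin 3) → ℝ := fun y'' => fderiv ℝ q y'' (rotGen (y'' - cf)) with hg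
  have h1 : ∀ a : EuclideanSpace ℝ (Fin 3), ContDiff ℝ 2 (fun y' => fderiv ℝ q y' a) := fun a =>
    (hq.fderiv_right (m := 2) (by norm_num)).clm_apply contDiff_const
  have hgeq : g = fun y'' => (y'' 0 - cf 0) * fderiv ℝ q y'' (EuclideanSpace.single 1 1) -
      (y'' 1 - cf 1) * fderiv ℝ q y'' (EuclideanSpace.single 0 1) := by
    funext y''; exact fderiv_rotGen_sub_eq q y'' cf
  have hgC : ContDiff ℝ 2 g := by
    rw [hgeq]
    have h0 : ContDiff ℝ 2 (fun y'' : EuclideanSpace ℝ (Fin 3) => y'' 0) :=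
      (EuclideanSpace.proj (0 : Fin 3) : EuclideanSpace ℝ (Fin 3) →L[ℝ] ℝ).contDiff
    have h1' : ContDiff ℝ 2 (fun y'' : EuclideanSpace ℝ (Fin 3) => y'' 1) :=
      (EuclideanSpace.proj (1 : Fin 3) : EuclideanSpace ℝ (Fin 3) →L[ℝ] ℝ).contDiff
    exact ((h0.sub contDiff_const).mul (h1 _)).sub ((h1'.sub contDiff_const).mul (h1 _))
  -- `g = 0` on `O ∩ {y'₂ = y₂}`
  have hg0 : ∀ y' ∈ O, y' 2 = y 2 → g y' = 0 := by
    intro y' hy' hy'z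
    rw [hgeq]; dsimp only
    rw [hcf0, hcf1, ← hy'z]
    exact hLq y' hy'
  -- first horizontal derivatives of `g` vanish on `O ∩ {y'₂ = y₂}`
  have hg1 : ∀ j : Fin 3, j ≠ 2 → ∀ y' ∈ O, y' 2 = y 2 → fderiv ℝ g y' (EuclideanSpace.single j 1) = 0 := by
    intro j hj y' hy' hy'z
    have heq : ∀ᶠ z in 𝓝 y', z 2 = y' 2 → g z = (fun _ => (0 : ℝ)) z :=
      Filter.eventually_of_mem (hO.mem_nhds hy') fun z hz hzz => hg0 z hz (hzz.trans hy'z)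
    rw [fderiv_apply_eq_of_eqOn_plane_nhds (hgC.differentiable (by norm_num) y') (differentiableAt_const _) heq hj,
      fderiv_fun_const]
    rfl
  -- second horizontal derivatives of `g` vanish at `y`
  have hg2 : ∀ j : Fin 3, j ≠ 2 →
      fderiv ℝ (fun y' => fderiv ℝ g y' (EuclideanSpace.single j 1)) y (EuclideanSpace.single j 1) = 0 := by
    intro j hj
    have hdg : DifferentiableAt ℝ (fun y' => fderiv ℝ g y' (EuclideanSpace.single j 1)) y :=
      (((hgC.fderiv_right (m := 1) (by norm_num)).clm_apply contDiff_const).differentiable (by norm_num)) y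
    have heq : ∀ᶠ z in 𝓝 y, z 2 = y 2 →
        (fun y' => fderiv ℝ g y' (EuclideanSpace.single j 1)) z = (fun _ => (0 : ℝ)) z :=
      Filter.eventually_of_mem (hO.mem_nhds hy) fun z hz hzz => hg1 j hj z hz hzz
    rw [fderiv_apply_eq_of_eqOn_plane_nhds hdg (differentiableAt_const _) heq hj, fderiv_fun_const]
    rfl
  -- the commutation identity with the frozen centre
  have hlap := laplacianH_rotDeriv hq cf y
  rw [hg2 0 (by decide), hg2 1 (by decide), add_zero, hcf0, hcf1] at hlap
  linarith

/-- **(S) IS KINEMATIC.**  For a divergence-free `u ∈ C³`, `q ∈ C³`, a centre curve `(c₀, c₁)` and an open `O` with (shear)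
`∂₂u_b = ∂_b q` (`b = 0,1`) and (radial) `L q = 0` on `O`: `L(∂₂²u₂) = 0` on `O` (`L = (y₀ − c₀(y₂))∂₁ − (y₁ − c₁(y₂))∂₀`) — the
hypothesis (S) of `…AxisKinematics13.deriv_centre_eq_zero` for `V = u₂`. -/
theorem vert2_rotInvariant_of_shear {u : EuclideanSpace ℝ (Fin 3) → EuclideanSpace ℝ (Fin 3)} (hu : ContDiff ℝ 3 u)
    {q : EuclideanSpace ℝ (Fin 3) → ℝ} (hq : ContDiff ℝ 3 q) (hdiv : VectorCalculus.IsDivFree u) {c₀ c₁ : ℝ → ℝ}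
    {O : Set (EuclideanSpace ℝ (Fin 3))} (hO : IsOpen O)
    (hshear : ∀ y ∈ O, ∀ b : Fin 3, b ≠ 2 →
      fderiv ℝ u y (EuclideanSpace.single 2 1) b = fderiv ℝ q y (EuclideanSpace.single b 1))
    (hLq : ∀ y ∈ O, (y 0 - c₀ (y 2)) * fderiv ℝ q y (EuclideanSpace.single 1 1) -
      (y 1 - c₁ (y 2)) * fderiv ℝ q y (EuclideanSpace.single 0 1) = 0)
    {y : EuclideanSpace ℝ (Fin 3)} (hy : y ∈ O) :
    (y 0 - c₀ (y 2)) *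
        fderiv ℝ (fun y' => fderiv ℝ (fun y'' => fderiv ℝ (fun x => u x 2) y'' (EuclideanSpace.single 2 1)) y'
          (EuclideanSpace.single 2 1)) y (EuclideanSpace.single 1 1) -
      (y 1 - c₁ (y 2)) *
        fderiv ℝ (fun y' => fderiv ℝ (fun y'' => fderiv ℝ (fun x => u x 2) y'' (EuclideanSpace.single 2 1)) y'
          (EuclideanSpace.single 2 1)) y (EuclideanSpace.single 0 1) = 0 := by
  -- `∂₂²u₂ = −Δ_h q` near `y`, hence the derivatives at `y` agree
  have hFG : (fun y' => fderiv ℝ (fun y'' => fderiv ℝ (fun x => u x 2) y'' (EuclideanSpace.single 2 1)) y'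
      (EuclideanSpace.single 2 1)) =ᶠ[𝓝 y]
      fun y' => -(fderiv ℝ (fun y'' => fderiv ℝ q y'' (EuclideanSpace.single 0 1)) y' (EuclideanSpace.single 0 1) +
        fderiv ℝ (fun y'' => fderiv ℝ q y'' (EuclideanSpace.single 1 1)) y' (EuclideanSpace.single 1 1)) :=
    Filter.eventually_of_mem (hO.mem_nhds hy) fun z hz => vert2_apply_two_eq_neg_laplacianH hu hdiv hO hshear hz
  rw [hFG.fderiv_eq, fderiv_fun_neg]
  simp only [_root_.neg_apply]
  have h := rotDeriv_laplacianH_eq_zero_of_plane hq hO hLq hy (c₀ := c₀) (c₁ := c₁)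
  linarith

end Summit.NavierStokesRegularity.NavierStokesRegularity.Theorems.PoloidalWindowDoorLrcModEntireAxisKinematics14

end
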